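import Summits.QuantumFields.YangMills.Theorems.UnitScaleTiltProp7ResolventSmoothedPairing
import HarnessLib

/-!
# Prop. 7 on T³ — lane II (B7-CORE): the abstract assembly of divergence recovery

Route `UnitScaleTilt`, crux `MinimiserStabilityRegPr` (stmt-QuantumFields-19200), E′ growth side, lane II «divergence recovery at the curved regular
member» (row (REC) = hypothesis `hRec` of ✓`Prop7HcoOfDivRecovery.hCo_of_divRecovery`).  This file is the HILBERT-SPACE CORE of the (B7) assembly
(★p1 g19 PLAN-B7 §1–§2), with every analytic brick entering as a displayed hypothesis in abstract operator letters; the member-level file instantiates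
`S :=` sites `L²`, `E :=` bonds `L²`, `D := D_W`, `Q′ :=` the comb block averaging of record, `J :=` the smooth right inverse (B2a), `Z i :=` multiplication
by the partition of unity `ζ_i` (B6), `φ i`, `κs i`, `r i :=` the local potentials, sources and transverse remainders (B8), `T :=` the straight tube average.

* §1 `localisation_identity` — from `Σ_i Z_i = 1` and the local potential equations `Z_i v = Z_i(Δφ_i) + Z_iκ_i`:
  `v = Δ(Σ_i Z_iφ_i) − Σ_i (Δ(Z_iφ_i) − Z_i(Δφ_i)) + Σ_i Z_iκ_i` (pure algebra, any linear `Δ`).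
* §2 `norm_le_three_terms` — the J-FREE bound (★): if `‖g‖² ≤ re⟪g, v⟫`, `g ⊥ Δ(ker Q′)` (`Δ = D†D`) and `J` is a right inverse of `Q′` with
  `‖D(J(Q′f))‖ ≤ κ‖f‖`, then `‖g‖ ≤ 4κ·‖D(J(Q′φ))‖ + ‖Σ_i [Δ, Z_i]φ_i‖ + ‖Σ_i Z_iκ_i‖`, `φ := Σ_i Z_iφ_i` — by §1 and (B13)
  ✓`Prop7ResolventSmoothedPairing.norm_inner_laplace_le_of_orthogonal_ker` at `x := J(Q′φ)` (`⟪g, Δφ⟫ = ⟪g, Δ(JQ′φ)⟫` since `φ − JQ′φ ∈ ker Q′`).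
* §3 `gradient_decomposition` — `D(Σ_i Z_iφ_i) = y − Σ_i Z^E_i r_i + Σ_i (D(Z_iφ_i) − Z^E_i(Dφ_i))` from `Σ_i Z^E_i = 1` and `Z^E_i(Dφ_i) = Z^E_i y − Z^E_i r_i`.
* §4 `norm_sq_le_rows` — (★) squared and chained through the displayed rows of the smooth right inverse (`‖D(Jw)‖² ≤ CJ·Gc w + CJ′e²·Nc w`), the tube
  intertwining (`Gc(Q′μ) ≤ 2‖T(Dμ)‖² + Ct·e²‖μ‖²`), the contraction rows `Nc(Q′μ) ≤ CN‖μ‖²`, `Gc w ≤ CG·Nc w`, `‖Tf‖² ≤ B‖f‖²`: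
  `‖g‖² ≤ 288κ²CJ·‖Ty‖² + 288κ²CJ·B·(‖Σ Z^E_i r_i‖² + ‖Σ [D,Z_i]φ_i‖²) + 48κ²(CJ·Ct + CJ′·CN)·e²·‖φ‖² + 3‖Σ[Δ,Z_i]φ_i‖² + 3‖ΣZ_iκ_i‖²`
  with `κ² = CJ·CG·CN + CJ′·CN·e² + 1`.

HONEST SCOPE.  Finite-dimensional Hilbert-space algebra and bookkeeping only; the rows are hypotheses; nothing of (REC)∕hN06∕hcoS∕E′∕EX∕the crux is proved
here; YM₃ on T³ is rung R3 of the ladder — NOT d = 4, NOT infinite volume, NOT a mass gap, NOT Clay.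
[cite: Balaban1985BackgroundPropagators, (3.10) p.392, (3.20)-(3.26) pp.394-395, Thm 3.11 p.416]
-/

noncomputable section

open scoped InnerProductSpace ComplexConjugate BigOperators

namespace Summit.QuantumFields.YangMills.Theorems.Prop7DivRecoveryAssemblyCore

open Summit.QuantumFields.YangMills.Theorems.Prop7ResolventSmoothedPairing (norm_inner_laplace_le_of_orthogonal_ker)

/-! ## §1 The localisation identity (pure algebra) -/

section Identity

variable {S : Type*} [AddCommGroup S] [Module ℂ S] {ι : Type*} [Fintype ι]

/-- **The localisation identity.**  `Δ : S → S` linear, `Z_i` linear with `Σ_i Z_i s = s`, and the local potential equations `Z_i v = Z_i(Δφ_i) + Z_iκ_i`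
give `v = Δ(Σ_i Z_iφ_i) − Σ_i (Δ(Z_iφ_i) − Z_i(Δφ_i)) + Σ_i Z_iκ_i`. [folklore] -/
theorem localisation_identity (Δ : S →ₗ[ℂ] S) (Z : ι → S →ₗ[ℂ] S) (hZ : ∀ s : S, ∑ i, Z i s = s) (v : S) (φ κs : ι → S)
    (hloc : ∀ i, Z i v = Z i (Δ (φ i)) + Z i (κs i)) :
    v = Δ (∑ i, Z i (φ i)) - ∑ i, (Δ (Z i (φ i)) - Z i (Δ (φ i))) + ∑ i, Z i (κs i) := by
  have h1 : v = ∑ i, (Z i (Δ (φ i)) + Z i (κs i)) := by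
    rw [← Finset.sum_congr rfl (fun i _ => hloc i), hZ]
  rw [map_sum, Finset.sum_sub_distrib, h1, Finset.sum_add_distrib]
  abel

end Identity

/-! ## §2 The J-free three-term bound (★) -/

section ThreeTerms

variable {S E : Type*} [NormedAddCommGroup S] [InnerProductSpace ℂ S] [FiniteDimensional ℂ S]
  [NormedAddCommGroup E] [InnerProductSpace ℂ E] [FiniteDimensional ℂ E]
  {ι : Type*} [Fintype ι]

omit [FiniteDimensional ℂ S] in
/-- `re⟪g, x⟫ ≤ ‖g‖‖x‖` (complex Hilbert space). -/
theorem re_inner_le_norm_mul_norm (g x : S) : RCLike.re ⟪g, x⟫_ℂ ≤ ‖g‖ * ‖x‖ :=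
  (RCLike.re_le_norm _).trans (norm_inner_le_norm g x)

/-- ★★★ **(★) THE J-FREE THREE-TERM BOUND.**  `D : S → E`, `Δ := D†D`; `Q′ : S → C` with right inverse `J` and the crude gradient constant
`‖D(J(Q′f))‖ ≤ κ‖f‖`; cutoffs `Z_i` with `Σ_i Z_i = 1`; local potentials `Z_i v = Z_i(Δφ_i) + Z_iκ_i`; `g` with `‖g‖² ≤ re⟪g, v⟫` (at the member
`g = v − Rv`, `R` an orthogonal projection) and `g ⊥ Δ(ker Q′)`.  Then, with `φ := Σ_i Z_iφ_i`,
`‖g‖ ≤ 4κ·‖D(J(Q′φ))‖ + ‖Σ_i (Δ(Z_iφ_i) − Z_i(Δφ_i))‖ + ‖Σ_i Z_iκ_i‖`.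
Proof: §1, `‖g‖² ≤ re⟪g, Δφ⟫ − re⟪g, Σ[Δ,Z_i]φ_i⟫ + re⟪g, ΣZ_iκ_i⟫`, `⟪g, Δφ⟫ = ⟪g, Δ(JQ′φ)⟫` (`φ − JQ′φ ∈ ker Q′`) and (B13)
✓`norm_inner_laplace_le_of_orthogonal_ker` at `x := J(Q′φ)`. [cite: Balaban1985BackgroundPropagators, (3.20)-(3.26) pp.394-395] -/
theorem norm_le_three_terms {C : Type*} [AddCommGroup C] [Module ℂ C]
    (D : S →ₗ[ℂ] E) (Q' : S →ₗ[ℂ] C) (J : C →ₗ[ℂ] S) (hQJ : ∀ u : C, Q' (J u) = u) {κ : ℝ} (hκ : 0 < κ)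
    (hJ : ∀ f : S, ‖D (J (Q' f))‖ ≤ κ * ‖f‖)
    (Z : ι → S →ₗ[ℂ] S) (hZ : ∀ s : S, ∑ i, Z i s = s) (v g : S)
    (hgv : ‖g‖ ^ 2 ≤ RCLike.re ⟪g, v⟫_ℂ)
    (hg : ∀ l : S, Q' l = 0 → ⟪g, LinearMap.adjoint D (D l)⟫_ℂ = 0)
    (φ κs : ι → S) (hloc : ∀ i, Z i v = Z i (LinearMap.adjoint D (D (φ i))) + Z i (κs i)) :
    ‖g‖ ≤ 4 * κ * ‖D (J (Q' (∑ i, Z i (φ i))))‖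
        + ‖∑ i, (LinearMap.adjoint D (D (Z i (φ i))) - Z i (LinearMap.adjoint D (D (φ i))))‖ + ‖∑ i, Z i (κs i)‖ := by
  set Δ : S →ₗ[ℂ] S := LinearMap.adjoint D ∘ₗ D with hΔ
  have hΔapp : ∀ s : S, Δ s = LinearMap.adjoint D (D s) := fun s => rfl
  set Φ : S := ∑ i, Z i (φ i) with hΦ
  set Cm : S := ∑ i, (LinearMap.adjoint D (D (Z i (φ i))) - Z i (LinearMap.adjoint D (D (φ i)))) with hCm
  set Kp : S := ∑ i, Z i (κs i) with hKp
  -- §1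
  have hv : v = Δ Φ - Cm + Kp := by
    have := localisation_identity Δ Z hZ v φ κs (fun i => by rw [hΔapp]; exact hloc i)
    simpa only [hΔapp] using this
  -- the pairing with `Δ Φ` through `J (Q' Φ)`
  have hx : ⟪g, LinearMap.adjoint D (D Φ)⟫_ℂ = ⟪g, LinearMap.adjoint D (D (J (Q' Φ)))⟫_ℂ := by
    have hker : Q' (Φ - J (Q' Φ)) = 0 := by rw [map_sub, hQJ, sub_self]
    have h0 := hg _ hker
    rw [map_sub, map_sub, inner_sub_right, sub_eq_zero] at h0
    exact h0
  have hB13 : ‖⟪g, LinearMap.adjoint D (D Φ)⟫_ℂ‖ ≤ 4 * κ * ‖g‖ * ‖D (J (Q' Φ))‖ := by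
    rw [hx]
    exact norm_inner_laplace_le_of_orthogonal_ker D Q' J hQJ hκ hJ g hg (J (Q' Φ))
  -- expand `re⟪g, v⟫`
  have hre : RCLike.re ⟪g, v⟫_ℂ = RCLike.re ⟪g, Δ Φ⟫_ℂ - RCLike.re ⟪g, Cm⟫_ℂ + RCLike.re ⟪g, Kp⟫_ℂ := by
    rw [hv, inner_add_right, inner_sub_right, map_add, map_sub]
  have h1 : RCLike.re ⟪g, Δ Φ⟫_ℂ ≤ 4 * κ * ‖g‖ * ‖D (J (Q' Φ))‖ :=
    (RCLike.re_le_norm _).trans (by rw [hΔapp]; exact hB13)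
  have h2 : -RCLike.re ⟪g, Cm⟫_ℂ ≤ ‖g‖ * ‖Cm‖ := by
    have := re_inner_le_norm_mul_norm g (-Cm)
    rwa [inner_neg_right, map_neg, norm_neg] at this
  have h3 : RCLike.re ⟪g, Kp⟫_ℂ ≤ ‖g‖ * ‖Kp‖ := re_inner_le_norm_mul_norm g Kp
  have hsq : ‖g‖ ^ 2 ≤ ‖g‖ * (4 * κ * ‖D (J (Q' Φ))‖ + ‖Cm‖ + ‖Kp‖) := by
    calc ‖g‖ ^ 2 ≤ RCLike.re ⟪g, v⟫_ℂ := hgv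
      _ ≤ 4 * κ * ‖g‖ * ‖D (J (Q' Φ))‖ + ‖g‖ * ‖Cm‖ + ‖g‖ * ‖Kp‖ := by rw [hre]; linarith
      _ = ‖g‖ * (4 * κ * ‖D (J (Q' Φ))‖ + ‖Cm‖ + ‖Kp‖) := by ring
  by_cases hg0 : ‖g‖ = 0
  · rw [hg0]; positivity
  · have hgpos : 0 < ‖g‖ := lt_of_le_of_ne (norm_nonneg g) (Ne.symm hg0)
    have := le_of_mul_le_mul_left (by simpa only [pow_two] using hsq) hgpos
    exact this

/-- (★) squared: `‖g‖² ≤ 3·(16κ²·‖D(J(Q′φ))‖² + ‖Σ[Δ,Z_i]φ_i‖² + ‖ΣZ_iκ_i‖²)`. -/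
theorem norm_sq_le_three_terms {C : Type*} [AddCommGroup C] [Module ℂ C]
    (D : S →ₗ[ℂ] E) (Q' : S →ₗ[ℂ] C) (J : C →ₗ[ℂ] S) (hQJ : ∀ u : C, Q' (J u) = u) {κ : ℝ} (hκ : 0 < κ)
    (hJ : ∀ f : S, ‖D (J (Q' f))‖ ≤ κ * ‖f‖)
    (Z : ι → S →ₗ[ℂ] S) (hZ : ∀ s : S, ∑ i, Z i s = s) (v g : S)
    (hgv : ‖g‖ ^ 2 ≤ RCLike.re ⟪g, v⟫_ℂ)
    (hg : ∀ l : S, Q' l = 0 → ⟪g, LinearMap.adjoint D (D l)⟫_ℂ = 0)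
    (φ κs : ι → S) (hloc : ∀ i, Z i v = Z i (LinearMap.adjoint D (D (φ i))) + Z i (κs i)) :
    ‖g‖ ^ 2 ≤ 3 * (16 * κ ^ 2 * ‖D (J (Q' (∑ i, Z i (φ i))))‖ ^ 2
        + ‖∑ i, (LinearMap.adjoint D (D (Z i (φ i))) - Z i (LinearMap.adjoint D (D (φ i))))‖ ^ 2 + ‖∑ i, Z i (κs i)‖ ^ 2) := by
  have h := norm_le_three_terms D Q' J hQJ hκ hJ Z hZ v g hgv hg φ κs hloc
  set a := ‖D (J (Q' (∑ i, Z i (φ i))))‖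
  set b := ‖∑ i, (LinearMap.adjoint D (D (Z i (φ i))) - Z i (LinearMap.adjoint D (D (φ i))))‖
  set c := ‖∑ i, Z i (κs i)‖
  have ha : 0 ≤ a := norm_nonneg _
  have hb : 0 ≤ b := norm_nonneg _
  have hc : 0 ≤ c := norm_nonneg _
  have hg0 : 0 ≤ ‖g‖ := norm_nonneg _
  have hsq : ‖g‖ ^ 2 ≤ (4 * κ * a + b + c) ^ 2 := pow_le_pow_left₀ hg0 h 2
  nlinarith [sq_nonneg (4 * κ * a - b), sq_nonneg (b - c), sq_nonneg (4 * κ * a - c)]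

end ThreeTerms

/-! ## §3 The gradient of the glued potential -/

section Gradient

variable {S E : Type*} [AddCommGroup S] [Module ℂ S] [AddCommGroup E] [Module ℂ E] {ι : Type*} [Fintype ι]

/-- **`D(Σ_i Z_iφ_i) = y − Σ_i Z^E_i r_i + Σ_i (D(Z_iφ_i) − Z^E_i(Dφ_i))`** from `Σ_i Z^E_i f = f` and `Z^E_i(Dφ_i) = Z^E_i y − Z^E_i r_i`
(at the member: `r_i := y − D_Wφ_i` on the patch carrying `ζ_i`). [folklore] -/
theorem gradient_decomposition (D : S →ₗ[ℂ] E) (Z : ι → S →ₗ[ℂ] S) (ZE : ι → E →ₗ[ℂ] E) (hZE : ∀ f : E, ∑ i, ZE i f = f)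
    (φ : ι → S) (y : E) (r : ι → E) (hDφ : ∀ i, ZE i (D (φ i)) = ZE i y - ZE i (r i)) :
    D (∑ i, Z i (φ i)) = y - ∑ i, ZE i (r i) + ∑ i, (D (Z i (φ i)) - ZE i (D (φ i))) := by
  have h1 : ∑ i, ZE i (D (φ i)) = y - ∑ i, ZE i (r i) := by
    rw [Finset.sum_congr rfl (fun i _ => hDφ i), Finset.sum_sub_distrib, hZE]
  rw [map_sum, Finset.sum_sub_distrib, h1]
  abel

end Gradient

/-! ## §4 (★) chained through the displayed rows -/

section Rows

variable {S E : Type*} [NormedAddCommGroup S] [InnerProductSpace ℂ S] [FiniteDimensional ℂ S]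
  [NormedAddCommGroup E] [InnerProductSpace ℂ E] [FiniteDimensional ℂ E]
  {ι : Type*} [Fintype ι]

/-- `‖f₁ − f₂ + f₃‖² ≤ 3(‖f₁‖² + ‖f₂‖² + ‖f₃‖²)` in a normed group. -/
theorem norm_sq_sub_add_le_three {V : Type*} [NormedAddCommGroup V] (f₁ f₂ f₃ : V) :
    ‖f₁ - f₂ + f₃‖ ^ 2 ≤ 3 * (‖f₁‖ ^ 2 + ‖f₂‖ ^ 2 + ‖f₃‖ ^ 2) := by
  have h : ‖f₁ - f₂ + f₃‖ ≤ ‖f₁‖ + ‖f₂‖ + ‖f₃‖ := by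
    calc ‖f₁ - f₂ + f₃‖ ≤ ‖f₁ - f₂‖ + ‖f₃‖ := norm_add_le _ _
      _ ≤ ‖f₁‖ + ‖f₂‖ + ‖f₃‖ := by have := norm_sub_le f₁ f₂; linarith
  have h0 : 0 ≤ ‖f₁ - f₂ + f₃‖ := norm_nonneg _
  have hsq := pow_le_pow_left₀ h0 h 2
  nlinarith [sq_nonneg (‖f₁‖ - ‖f₂‖), sq_nonneg (‖f₂‖ - ‖f₃‖), sq_nonneg (‖f₁‖ - ‖f₃‖), norm_nonneg f₁, norm_nonneg f₂, norm_nonneg f₃]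

omit [FiniteDimensional ℂ S] [FiniteDimensional ℂ E] in
/-- The crude gradient constant of `J ∘ Q′` from the rows: `‖D(J(Q′f))‖ ≤ κ‖f‖` with `κ := √(CJ·CG·CN + CJ′·CN·e² + 1)` (`> 0`). -/
theorem norm_D_J_Q_le {C : Type*} [AddCommGroup C] [Module ℂ C]
    (D : S →ₗ[ℂ] E) (Q' : S →ₗ[ℂ] C) (J : C →ₗ[ℂ] S) (Gc Nc : C → ℝ) {CJ CJ' CG CN e : ℝ}
    (hCJ : 0 ≤ CJ) (hCJ' : 0 ≤ CJ') (hCG : 0 ≤ CG) (hCN : 0 ≤ CN) (hNc0 : ∀ w, 0 ≤ Nc w)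
    (hJrow : ∀ w : C, ‖D (J w)‖ ^ 2 ≤ CJ * Gc w + CJ' * e ^ 2 * Nc w)
    (hGN : ∀ w : C, Gc w ≤ CG * Nc w) (hNc : ∀ μ : S, Nc (Q' μ) ≤ CN * ‖μ‖ ^ 2) (f : S) :
    ‖D (J (Q' f))‖ ≤ Real.sqrt (CJ * CG * CN + CJ' * CN * e ^ 2 + 1) * ‖f‖ := by
  have hf0 : 0 ≤ ‖f‖ := norm_nonneg f
  have hN0 := hNc0 (Q' f)
  have h1 : ‖D (J (Q' f))‖ ^ 2 ≤ (CJ * CG * CN + CJ' * CN * e ^ 2 + 1) * ‖f‖ ^ 2 := by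
    calc ‖D (J (Q' f))‖ ^ 2 ≤ CJ * Gc (Q' f) + CJ' * e ^ 2 * Nc (Q' f) := hJrow (Q' f)
      _ ≤ CJ * (CG * Nc (Q' f)) + CJ' * e ^ 2 * Nc (Q' f) := by nlinarith [hGN (Q' f)]
      _ = (CJ * CG + CJ' * e ^ 2) * Nc (Q' f) := by ring
      _ ≤ (CJ * CG + CJ' * e ^ 2) * (CN * ‖f‖ ^ 2) := mul_le_mul_of_nonneg_left (hNc f) (by positivity)
      _ ≤ (CJ * CG * CN + CJ' * CN * e ^ 2 + 1) * ‖f‖ ^ 2 := by nlinarith [sq_nonneg ‖f‖]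
  have h2 : 0 ≤ CJ * CG * CN + CJ' * CN * e ^ 2 + 1 := by positivity
  calc ‖D (J (Q' f))‖ = Real.sqrt (‖D (J (Q' f))‖ ^ 2) := (Real.sqrt_sq (norm_nonneg _)).symm
    _ ≤ Real.sqrt ((CJ * CG * CN + CJ' * CN * e ^ 2 + 1) * ‖f‖ ^ 2) := Real.sqrt_le_sqrt h1
    _ = Real.sqrt (CJ * CG * CN + CJ' * CN * e ^ 2 + 1) * ‖f‖ := by
        rw [Real.sqrt_mul h2, Real.sqrt_sq hf0]

/-- ★★★ **(B7-CORE) `‖g‖²` THROUGH THE DISPLAYED ROWS.**  Letters of `norm_le_three_terms`; in addition: bond cutoffs `Z^E_i` with `Σ_i Z^E_i = 1` and the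
patch rows `Z^E_i(Dφ_i) = Z^E_i y − Z^E_i r_i`; coarse currencies `Gc` (covariant coarse gradient) and `Nc ≥ 0` (coarse mass) with `Gc ≤ CG·Nc`,
`Nc(Q′μ) ≤ CN‖μ‖²`; the SMOOTH RIGHT INVERSE row (B2a) `‖D(Jw)‖² ≤ CJ·Gc w + CJ′·e²·Nc w`; the TUBE intertwining row (B3-tube)
`Gc(Q′μ) ≤ 2‖T(Dμ)‖² + Ct·e²·‖μ‖²` for a linear `T : E → E'` with `‖Tf‖² ≤ B‖f‖²`.  Then
`‖g‖² ≤ 288κ²CJ·‖Ty‖² + 288κ²CJ·B·(‖Σ_i Z^E_i r_i‖² + ‖Σ_i (D(Z_iφ_i) − Z^E_i(Dφ_i))‖²) + 48κ²(CJ·Ct + CJ′·CN)·e²·‖Σ_i Z_iφ_i‖²`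
`        + 3‖Σ_i (Δ(Z_iφ_i) − Z_i(Δφ_i))‖² + 3‖Σ_i Z_iκ_i‖²`, `κ² = CJ·CG·CN + CJ′·CN·e² + 1`.
[cite: Balaban1985BackgroundPropagators, (3.10) p.392, (3.20)-(3.26) pp.394-395] -/
theorem norm_sq_le_rows {C : Type*} [AddCommGroup C] [Module ℂ C] {E' : Type*} [NormedAddCommGroup E'] [Module ℂ E']
    (D : S →ₗ[ℂ] E) (Q' : S →ₗ[ℂ] C) (J : C →ₗ[ℂ] S) (hQJ : ∀ u : C, Q' (J u) = u)
    (Gc Nc : C → ℝ) {CJ CJ' CG CN Ct B e : ℝ} (hCJ : 0 ≤ CJ) (hCJ' : 0 ≤ CJ') (hCG : 0 ≤ CG) (hCN : 0 ≤ CN)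
    (hNc0 : ∀ w, 0 ≤ Nc w)
    (hJrow : ∀ w : C, ‖D (J w)‖ ^ 2 ≤ CJ * Gc w + CJ' * e ^ 2 * Nc w)
    (hGN : ∀ w : C, Gc w ≤ CG * Nc w) (hNc : ∀ μ : S, Nc (Q' μ) ≤ CN * ‖μ‖ ^ 2)
    (T : E →ₗ[ℂ] E') (hT : ∀ f : E, ‖T f‖ ^ 2 ≤ B * ‖f‖ ^ 2)
    (htube : ∀ μ : S, Gc (Q' μ) ≤ 2 * ‖T (D μ)‖ ^ 2 + Ct * e ^ 2 * ‖μ‖ ^ 2)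
    (Z : ι → S →ₗ[ℂ] S) (hZ : ∀ s : S, ∑ i, Z i s = s) (ZE : ι → E →ₗ[ℂ] E) (hZE : ∀ f : E, ∑ i, ZE i f = f)
    (v g : S) (hgv : ‖g‖ ^ 2 ≤ RCLike.re ⟪g, v⟫_ℂ)
    (hg : ∀ l : S, Q' l = 0 → ⟪g, LinearMap.adjoint D (D l)⟫_ℂ = 0)
    (φ κs : ι → S) (hloc : ∀ i, Z i v = Z i (LinearMap.adjoint D (D (φ i))) + Z i (κs i))
    (y : E) (r : ι → E) (hDφ : ∀ i, ZE i (D (φ i)) = ZE i y - ZE i (r i)) :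
    ‖g‖ ^ 2 ≤ 288 * (CJ * CG * CN + CJ' * CN * e ^ 2 + 1) * CJ * ‖T y‖ ^ 2
        + 288 * (CJ * CG * CN + CJ' * CN * e ^ 2 + 1) * CJ * B
            * (‖∑ i, ZE i (r i)‖ ^ 2 + ‖∑ i, (D (Z i (φ i)) - ZE i (D (φ i)))‖ ^ 2)
        + 48 * (CJ * CG * CN + CJ' * CN * e ^ 2 + 1) * (CJ * Ct + CJ' * CN) * e ^ 2 * ‖∑ i, Z i (φ i)‖ ^ 2
        + 3 * ‖∑ i, (LinearMap.adjoint D (D (Z i (φ i))) - Z i (LinearMap.adjoint D (D (φ i))))‖ ^ 2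
        + 3 * ‖∑ i, Z i (κs i)‖ ^ 2 := by
  -- the crude gradient constant
  set K2 : ℝ := CJ * CG * CN + CJ' * CN * e ^ 2 + 1 with hK2
  have hK2pos : 0 < K2 := by rw [hK2]; positivity
  have hκ : 0 < Real.sqrt K2 := Real.sqrt_pos.mpr hK2pos
  have hJ : ∀ f : S, ‖D (J (Q' f))‖ ≤ Real.sqrt K2 * ‖f‖ := norm_D_J_Q_le D Q' J Gc Nc hCJ hCJ' hCG hCN hNc0 hJrow hGN hNc
  have hκsq : Real.sqrt K2 ^ 2 = K2 := Real.sq_sqrt hK2pos.le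
  -- (★) squared
  have h3 := norm_sq_le_three_terms D Q' J hQJ hκ hJ Z hZ v g hgv hg φ κs hloc
  rw [hκsq] at h3
  -- the chain for `‖D (J (Q' Φ))‖²`
  set Φ : S := ∑ i, Z i (φ i) with hΦ
  have hgrad : D Φ = y - ∑ i, ZE i (r i) + ∑ i, (D (Z i (φ i)) - ZE i (D (φ i))) :=
    gradient_decomposition D Z ZE hZE φ y r hDφ
  have hTD : ‖T (D Φ)‖ ^ 2 ≤ 3 * (‖T y‖ ^ 2 + B * ‖∑ i, ZE i (r i)‖ ^ 2 + B * ‖∑ i, (D (Z i (φ i)) - ZE i (D (φ i)))‖ ^ 2) := by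
    rw [hgrad, map_add, map_sub]
    have h := norm_sq_sub_add_le_three (T y) (T (∑ i, ZE i (r i))) (T (∑ i, (D (Z i (φ i)) - ZE i (D (φ i)))))
    have h2 := hT (∑ i, ZE i (r i))
    have h3' := hT (∑ i, (D (Z i (φ i)) - ZE i (D (φ i))))
    linarith
  have hDJ : ‖D (J (Q' Φ))‖ ^ 2 ≤ CJ * (2 * ‖T (D Φ)‖ ^ 2 + Ct * e ^ 2 * ‖Φ‖ ^ 2) + CJ' * e ^ 2 * (CN * ‖Φ‖ ^ 2) := by
    calc ‖D (J (Q' Φ))‖ ^ 2 ≤ CJ * Gc (Q' Φ) + CJ' * e ^ 2 * Nc (Q' Φ) := hJrow (Q' Φ)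
      _ ≤ CJ * (2 * ‖T (D Φ)‖ ^ 2 + Ct * e ^ 2 * ‖Φ‖ ^ 2) + CJ' * e ^ 2 * (CN * ‖Φ‖ ^ 2) := by
          have hA := mul_le_mul_of_nonneg_left (htube Φ) hCJ
          have hB' := mul_le_mul_of_nonneg_left (hNc Φ) (show 0 ≤ CJ' * e ^ 2 by positivity)
          linarith
  -- collect
  have hK2nn : 0 ≤ K2 := hK2pos.le
  have hmain : 16 * K2 * ‖D (J (Q' Φ))‖ ^ 2 ≤ 96 * K2 * CJ * ‖T y‖ ^ 2
      + 96 * K2 * CJ * B * (‖∑ i, ZE i (r i)‖ ^ 2 + ‖∑ i, (D (Z i (φ i)) - ZE i (D (φ i)))‖ ^ 2)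
      + 16 * K2 * (CJ * Ct + CJ' * CN) * e ^ 2 * ‖Φ‖ ^ 2 := by
    have hC2 : 0 ≤ K2 * CJ := by positivity
    have step : ‖D (J (Q' Φ))‖ ^ 2 ≤ 6 * CJ * ‖T y‖ ^ 2
        + 6 * CJ * B * (‖∑ i, ZE i (r i)‖ ^ 2 + ‖∑ i, (D (Z i (φ i)) - ZE i (D (φ i)))‖ ^ 2)
        + (CJ * Ct + CJ' * CN) * e ^ 2 * ‖Φ‖ ^ 2 := by
      have := mul_le_mul_of_nonneg_left hTD (show 0 ≤ 2 * CJ by positivity)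
      nlinarith
    have := mul_le_mul_of_nonneg_left step (show 0 ≤ 16 * K2 by positivity)
    nlinarith
  nlinarith

end Rows


/-! ## §5 (v1.1, pure append) The rows with an `H¹`-type bound on `T` — the shape for `T := Q_k(W)` itself

LANE II NAMER WORD №9: with `T :=` the comb averaging of record (`htube` = the EXACT intertwining (B3a), first term = the resource `AVG`), the op-norm row
`‖Tf‖² ≤ B‖f‖²` is not K-uniform; it is replaced by `‖Tf‖² ≤ B‖f‖² + B′·H f` for an arbitrary functional `H : E → ℝ` (at the member the local
`curl`∕`div` energy of `f` — the true average is an `L²` contraction and the corner legs are Hardy-class), applied only to the two localisation remainders. -/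

section RowsH1

variable {S E : Type*} [NormedAddCommGroup S] [InnerProductSpace ℂ S] [FiniteDimensional ℂ S]
  [NormedAddCommGroup E] [InnerProductSpace ℂ E] [FiniteDimensional ℂ E]
  {ι : Type*} [Fintype ι]

/-- ★★★ **(B7-CORE, v1.1) `‖g‖²` THROUGH THE DISPLAYED ROWS, `H¹`-ROW ON `T`.**  As `norm_sq_le_rows` with `hT` replaced by
`hT' : ‖T f‖² ≤ B‖f‖² + B′·H f`; conclusion
`‖g‖² ≤ 288κ²CJ·‖Ty‖² + 288κ²CJ·B·(‖Σ ZE_i r_i‖² + ‖Σ (D(Z_iφ_i) − ZE_i(Dφ_i))‖²) + 288κ²CJ·B′·(H(Σ ZE_i r_i) + H(Σ (D(Z_iφ_i) − ZE_i(Dφ_i))))`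
`        + 48κ²(CJ·Ct + CJ′·CN)·e²·‖Σ Z_iφ_i‖² + 3‖Σ (Δ(Z_iφ_i) − Z_i(Δφ_i))‖² + 3‖Σ Z_iκ_i‖²`, `κ² = CJ·CG·CN + CJ′·CN·e² + 1`.
[cite: Balaban1985BackgroundPropagators, (3.10) p.392, (3.19)-(3.26) pp.393-395] -/
theorem norm_sq_le_rows_H1 {C : Type*} [AddCommGroup C] [Module ℂ C] {E' : Type*} [NormedAddCommGroup E'] [Module ℂ E']
    (D : S →ₗ[ℂ] E) (Q' : S →ₗ[ℂ] C) (J : C →ₗ[ℂ] S) (hQJ : ∀ u : C, Q' (J u) = u)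
    (Gc Nc : C → ℝ) {CJ CJ' CG CN Ct B B' e : ℝ} (hCJ : 0 ≤ CJ) (hCJ' : 0 ≤ CJ') (hCG : 0 ≤ CG) (hCN : 0 ≤ CN)
    (hNc0 : ∀ w, 0 ≤ Nc w)
    (hJrow : ∀ w : C, ‖D (J w)‖ ^ 2 ≤ CJ * Gc w + CJ' * e ^ 2 * Nc w)
    (hGN : ∀ w : C, Gc w ≤ CG * Nc w) (hNc : ∀ μ : S, Nc (Q' μ) ≤ CN * ‖μ‖ ^ 2)
    (T : E →ₗ[ℂ] E') (H : E → ℝ) (hT' : ∀ f : E, ‖T f‖ ^ 2 ≤ B * ‖f‖ ^ 2 + B' * H f)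
    (htube : ∀ μ : S, Gc (Q' μ) ≤ 2 * ‖T (D μ)‖ ^ 2 + Ct * e ^ 2 * ‖μ‖ ^ 2)
    (Z : ι → S →ₗ[ℂ] S) (hZ : ∀ s : S, ∑ i, Z i s = s) (ZE : ι → E →ₗ[ℂ] E) (hZE : ∀ f : E, ∑ i, ZE i f = f)
    (v g : S) (hgv : ‖g‖ ^ 2 ≤ RCLike.re ⟪g, v⟫_ℂ)
    (hg : ∀ l : S, Q' l = 0 → ⟪g, LinearMap.adjoint D (D l)⟫_ℂ = 0)
    (φ κs : ι → S) (hloc : ∀ i, Z i v = Z i (LinearMap.adjoint D (D (φ i))) + Z i (κs i))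
    (y : E) (r : ι → E) (hDφ : ∀ i, ZE i (D (φ i)) = ZE i y - ZE i (r i)) :
    ‖g‖ ^ 2 ≤ 288 * (CJ * CG * CN + CJ' * CN * e ^ 2 + 1) * CJ * ‖T y‖ ^ 2
        + 288 * (CJ * CG * CN + CJ' * CN * e ^ 2 + 1) * CJ * B
            * (‖∑ i, ZE i (r i)‖ ^ 2 + ‖∑ i, (D (Z i (φ i)) - ZE i (D (φ i)))‖ ^ 2)
        + 288 * (CJ * CG * CN + CJ' * CN * e ^ 2 + 1) * CJ * B'
            * (H (∑ i, ZE i (r i)) + H (∑ i, (D (Z i (φ i)) - ZE i (D (φ i)))))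
        + 48 * (CJ * CG * CN + CJ' * CN * e ^ 2 + 1) * (CJ * Ct + CJ' * CN) * e ^ 2 * ‖∑ i, Z i (φ i)‖ ^ 2
        + 3 * ‖∑ i, (LinearMap.adjoint D (D (Z i (φ i))) - Z i (LinearMap.adjoint D (D (φ i))))‖ ^ 2
        + 3 * ‖∑ i, Z i (κs i)‖ ^ 2 := by
  -- the crude gradient constant
  set K2 : ℝ := CJ * CG * CN + CJ' * CN * e ^ 2 + 1 with hK2
  have hK2pos : 0 < K2 := by rw [hK2]; positivity
  have hκ : 0 < Real.sqrt K2 := Real.sqrt_pos.mpr hK2pos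
  have hJ : ∀ f : S, ‖D (J (Q' f))‖ ≤ Real.sqrt K2 * ‖f‖ := norm_D_J_Q_le D Q' J Gc Nc hCJ hCJ' hCG hCN hNc0 hJrow hGN hNc
  have hκsq : Real.sqrt K2 ^ 2 = K2 := Real.sq_sqrt hK2pos.le
  -- (★) squared
  have h3 := norm_sq_le_three_terms D Q' J hQJ hκ hJ Z hZ v g hgv hg φ κs hloc
  rw [hκsq] at h3
  -- the chain for `‖D (J (Q' Φ))‖²`
  set Φ : S := ∑ i, Z i (φ i) with hΦ
  set Fr : E := ∑ i, ZE i (r i) with hFr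
  set Fc : E := ∑ i, (D (Z i (φ i)) - ZE i (D (φ i))) with hFc
  have hgrad : D Φ = y - Fr + Fc := gradient_decomposition D Z ZE hZE φ y r hDφ
  have hTD : ‖T (D Φ)‖ ^ 2 ≤ 3 * (‖T y‖ ^ 2 + (B * ‖Fr‖ ^ 2 + B' * H Fr) + (B * ‖Fc‖ ^ 2 + B' * H Fc)) := by
    rw [hgrad, map_add, map_sub]
    have h := norm_sq_sub_add_le_three (T y) (T Fr) (T Fc)
    have h2 := hT' Fr
    have h3' := hT' Fc
    linarith
  have hDJ : ‖D (J (Q' Φ))‖ ^ 2 ≤ CJ * (2 * ‖T (D Φ)‖ ^ 2 + Ct * e ^ 2 * ‖Φ‖ ^ 2) + CJ' * e ^ 2 * (CN * ‖Φ‖ ^ 2) := by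
    calc ‖D (J (Q' Φ))‖ ^ 2 ≤ CJ * Gc (Q' Φ) + CJ' * e ^ 2 * Nc (Q' Φ) := hJrow (Q' Φ)
      _ ≤ CJ * (2 * ‖T (D Φ)‖ ^ 2 + Ct * e ^ 2 * ‖Φ‖ ^ 2) + CJ' * e ^ 2 * (CN * ‖Φ‖ ^ 2) := by
          have hA := mul_le_mul_of_nonneg_left (htube Φ) hCJ
          have hB' := mul_le_mul_of_nonneg_left (hNc Φ) (show 0 ≤ CJ' * e ^ 2 by positivity)
          linarith
  -- collect
  have hmain : 16 * K2 * ‖D (J (Q' Φ))‖ ^ 2 ≤ 96 * K2 * CJ * ‖T y‖ ^ 2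
      + 96 * K2 * CJ * B * (‖Fr‖ ^ 2 + ‖Fc‖ ^ 2) + 96 * K2 * CJ * B' * (H Fr + H Fc)
      + 16 * K2 * (CJ * Ct + CJ' * CN) * e ^ 2 * ‖Φ‖ ^ 2 := by
    have step : ‖D (J (Q' Φ))‖ ^ 2 ≤ 6 * CJ * ‖T y‖ ^ 2
        + 6 * CJ * B * (‖Fr‖ ^ 2 + ‖Fc‖ ^ 2) + 6 * CJ * B' * (H Fr + H Fc)
        + (CJ * Ct + CJ' * CN) * e ^ 2 * ‖Φ‖ ^ 2 := by
      have := mul_le_mul_of_nonneg_left hTD (show 0 ≤ 2 * CJ by positivity)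
      nlinarith
    have := mul_le_mul_of_nonneg_left step (show 0 ≤ 16 * K2 by positivity)
    nlinarith
  nlinarith

end RowsH1

end Summit.QuantumFields.YangMills.Theorems.Prop7DivRecoveryAssemblyCore

end
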